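import Mathlib
import HarnessLib

/-!
# Biased nearest-neighbour walk: the ruin probabilities `P_k{τ_n < τ_0} = ([(1−p)/p]^k − 1)/([(1−p)/p]^n − 1)` (Levin–Peres–Wilmer Example 9.9, eq. (9.20))

HONEST FRAMING: exact (Metropolis-corrected) sampling algorithms for lattice gauge theory; figures
of merit are autocorrelation/cost numbers at stated couplings and volumes; no continuum-physics claim.

Source: D. A. Levin, Y. Peres (with E. L. Wilmer), *Markov Chains and Mixing Times*, 2nd ed.,
AMS 2017 [LevinPeres2017], §9.4 EXAMPLE 9.9 (biased nearest-neighbor random walk on the path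
`{0, 1, …, n}`: "when at an interior vertex, moves up with probability `p` and down with probability
`1 − p`"), eq. (9.20), p. 121; companion of `GamblersRuin.lean` (the unbiased case `p = ½`,
Prop. 2.1).  Everything is PROVED (0 named facts, 0 definitions).

As in `GamblersRuin.lean`, what is formalised is the SOLVING STEP: the first-step (harmonicity)
system for `p_k = P_k{τ_n < τ_0}` — `p_0 = 0`, `p_n = 1`, `p_k = p·p_{k+1} + (1 − p)·p_{k−1}`
(`1 ≤ k ≤ n − 1`), i.e. `p_·` is the harmonic extension of `1_{n}` off `{0, n}` (Prop. 9.1 / eq. (9.13))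
— has, for `p ∉ {0, ½, 1}`, the unique solution **(9.20)** `p_k = (r^k − 1)/(r^n − 1)` with
`r = (1 − p)/p`.  The book obtains (9.20) from the series law for resistances (`r₁`, `r₂` in
Example 9.9); here the system is solved directly: the increments `p_{k+1} − p_k` form a geometric
progression of ratio `r`, and `Σ_{i<k} r^i = (r^k − 1)/(r − 1)`.

* `geometric_increments` — `p·(p_{k+1} − p_k) = (1−p)·(p_k − p_{k−1})` forces
  `p_{k} − p_{k−1} = r^{k−1}(p_1 − p_0)` [cite: LevinPeres2017, §9.4 Example 9.9 (the walk's
  first-step structure)];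
* **EQ. (9.20)** `LevinPeres2017_eq_9_20` — `p_k = ([(1−p)/p]^k − 1)/([(1−p)/p]^n − 1)` for
  `0 ≤ k ≤ n` [cite: LevinPeres2017, §9.4 Example 9.9, eq. (9.20)].
NOT CLAIMED: the identification `p_k = P_k{τ_n < τ_0}` (path space / Prop. 9.1's formula) and the
series-law derivation; the limit statement after (9.19).

Context (cell pub-lqcd): the exponential suppression `≈ r^{−(n−k)}` of reaching the far end against a
drift is the elementary model for barrier-crossing (sector-changing) probabilities of a biased local
update.
-/

namespace Literature.Probability.MarkovChains

open Finset

/-- For a solution of the interior equations `p_k = p·p_{k+1} + (1−p)·p_{k−1}` (`1 ≤ k ≤ n−1`) with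
`p ≠ 0`, the increments are geometric: `p_{k+1} − p_k = r^k (p_1 − p_0)` for `k + 1 ≤ n`, where
`r = (1 − p)/p`. [cite: LevinPeres2017, §9.4 Example 9.9 (first-step structure of the biased walk)] -/
theorem geometric_increments {n : ℕ} {p : ℝ} {f : ℕ → ℝ} (hp : p ≠ 0)
    (hh : ∀ k, 1 ≤ k → k + 1 ≤ n → f k = p * f (k + 1) + (1 - p) * f (k - 1)) :
    ∀ k, k + 1 ≤ n → f (k + 1) - f k = ((1 - p) / p) ^ k * (f 1 - f 0) := by
  intro k
  induction k with
  | zero => intro _; simp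
  | succ k ih =>
    intro hk
    have hprev := ih (by omega)
    have hstep := hh (k + 1) (by omega) hk
    simp only [Nat.add_sub_cancel] at hstep
    -- `p (f(k+2) − f(k+1)) = (1 − p)(f(k+1) − f k)`
    have h1 : f (k + 1 + 1) - f (k + 1) = (1 - p) / p * (f (k + 1) - f k) := by
      field_simp
      linarith [hstep]
    rw [h1, hprev, pow_succ]
    ring

/-- **EQ. (9.20) (biased gambler's ruin / Example 9.9)**: if `p_0 = 0`, `p_n = 1` and
`p_k = p·p_{k+1} + (1 − p)·p_{k−1}` for `1 ≤ k ≤ n − 1`, with `p ≠ 0` and `p ≠ ½`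
(so `r = (1 − p)/p ≠ 1`), then **`p_k = (r^k − 1)/(r^n − 1)`** for `0 ≤ k ≤ n` — in the book
`p_k = P_k{τ_n < τ_0} = ([(1−p)/p]^k − 1)/([(1−p)/p]^n − 1)`. [cite: LevinPeres2017, §9.4
Example 9.9, eq. (9.20)] -/
theorem LevinPeres2017_eq_9_20 {n : ℕ} {p : ℝ} {f : ℕ → ℝ} (hp : p ≠ 0) (hhalf : p ≠ 1 / 2)
    (hf0 : f 0 = 0) (hfn : f n = 1)
    (hh : ∀ k, 1 ≤ k → k + 1 ≤ n → f k = p * f (k + 1) + (1 - p) * f (k - 1)) :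
    ∀ k, k ≤ n → f k = (((1 - p) / p) ^ k - 1) / (((1 - p) / p) ^ n - 1) := by
  set r : ℝ := (1 - p) / p with hr
  have hr1 : r ≠ 1 := by
    intro h
    rw [hr, div_eq_one_iff_eq hp] at h
    apply hhalf
    linarith
  -- telescoping: `f k = (f 1 − f 0) Σ_{i<k} r^i = (f 1 − f 0)(r^k − 1)/(r − 1)`
  have htel : ∀ k, k ≤ n → f k = (f 1 - f 0) * ((r ^ k - 1) / (r - 1)) := by
    intro k
    induction k with
    | zero => intro _; simp [hf0]
    | succ k ih =>
      intro hk
      have hinc := geometric_increments hp hh k hk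
      rw [← hr] at hinc
      have e : f (k + 1) = f k + r ^ k * (f 1 - f 0) := by linarith
      rw [e, ih (by omega), ← geom_sum_eq hr1 k, ← geom_sum_eq hr1 (k + 1), sum_range_succ]
      ring
  -- the boundary value at `n` fixes `f 1 − f 0`
  have hn : r ^ n - 1 ≠ 0 := by
    intro h0
    have := htel n le_rfl
    rw [hfn, h0, zero_div, mul_zero] at this
    exact one_ne_zero this
  have hd : f 1 - f 0 = (r - 1) / (r ^ n - 1) := by
    have := htel n le_rfl
    rw [hfn] at this
    have hr1' : r - 1 ≠ 0 := sub_ne_zero.2 hr1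
    field_simp at this ⊢
    linarith
  intro k hk
  rw [htel k hk, hd]
  have hr1' : r - 1 ≠ 0 := sub_ne_zero.2 hr1
  field_simp

end Literature.Probability.MarkovChains
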